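import Summits.CriticalPhenomena.PercolationContinuityZ3.Theorems.PercNearOneGluingNoHeavyConstsClusterSquareNDC
import HarnessLib

/-!
# The cluster-square inequality under "no double clash among configurations of positive pairs"

builds on p205010 (kernel theorem, internal audit signed; external expert review pending)

PAPER-2 track "percolation constants", part (ii), seat `prim-consts-1`, gen 17 (lane index
`run/shared/lean/prim/consts/CONSTANTS.md`, row A19; memo `FROM-prim-consts-1-g17-THREE-COPY-STRUCTURE.md` §2).
Support file for the crux `NoHeavyLowerTail` (stmt-CriticalPhenomena-4575; `--supports`).  Theorems only; no sorries.

`…ConstsClusterSquareNDC.lean` proves `T ≤ μ(b↮c)² + P(E ∩ {double clash})` for every finite weighted graph and deduces CSQ at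
`(a; b, c)` (hence DUU and TS) when no double clash occurs, the hypothesis being stated for ALL configurations `ω, η` — including
configurations with open pairs of weight zero, which never occur.  This file removes them: configurations containing a pair of weight
zero have weight zero (`Consts.wtW_eq_zero_of_not_subset_pos`), so the double-clash term only sees pairs of configurations supported
on the positive pairs, and it suffices to exclude double clashes for configurations `ω, η ⊆ {e : 0 < w e}` — a hypothesis about the
positive-weight graph alone (`Consts.clusterSquare_le_sq_of_noDoubleClash_pos`, with the DUU and TS corollaries).
Reference: N. Gladkov, arXiv:2408.08457v2 (2024), Thm. 4.3, Def. 4.2, Lemma 3.1, Example 2.5.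
-/

noncomputable section

open Classical

namespace Summit.CriticalPhenomena.PercolationContinuityZ3.Theorems

open MeasureTheory Finset Literature.Probability.LatticeModels Literature.Probability.Percolation
open Literature.Probability.Percolation.DecisionTree Literature.Probability.Percolation.BHK2006
open Literature.Probability.Percolation.TargetExploration Literature.Probability.Percolation.ClusterConditioning

namespace Consts

section General

variable {V : Type*} [Fintype V]

/-- `Pr2W` only sees pairs of configurations supported on the pairs of positive weight. [folklore] -/
theorem Pr2W_eq_Pr2W_inter_supported (w : Sym2 V → unitInterval) {P : Finset (Sym2 V)}
    (hP : ∀ e, e ∈ P ↔ (0 : ℝ) < w e) (Y : Set (Finset (Sym2 V) × Finset (Sym2 V))) :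
    Pr2W Finset.univ (fun e => (w e : ℝ)) Y =
      Pr2W Finset.univ (fun e => (w e : ℝ)) (Y ∩ {x | x.1 ⊆ P ∧ x.2 ⊆ P}) := by
  unfold Pr2W
  refine Finset.sum_congr rfl fun x _ => ?_
  by_cases hx : x ∈ Y
  · by_cases hs : x.1 ⊆ P ∧ x.2 ⊆ P
    · rw [Set.indicator_of_mem hx, Set.indicator_of_mem (show x ∈ Y ∩ {x | x.1 ⊆ P ∧ x.2 ⊆ P} from ⟨hx, hs⟩)]
    · rw [Set.indicator_of_mem hx, Set.indicator_of_notMem (show x ∉ Y ∩ {x | x.1 ⊆ P ∧ x.2 ⊆ P} from fun h => hs h.2)]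
      unfold wt2W
      rcases not_and_or.1 hs with h | h
      · rw [wtW_eq_zero_of_not_subset_pos w hP h, zero_mul]
      · rw [wtW_eq_zero_of_not_subset_pos w hP h, mul_zero]
  · rw [Set.indicator_of_notMem hx, Set.indicator_of_notMem (show x ∉ Y ∩ {x | x.1 ⊆ P ∧ x.2 ⊆ P} from fun h => hx h.1)]

/-- **CSQ at `(a; b, c)` when no double clash occurs among configurations of POSITIVE pairs** (general finite vertex type): it
suffices to exclude double clashes for `ω, η` all of whose pairs have positive weight.
[cite: Gladkov2024, Thm. 4.3 (decision-tree vdBK) with Def. 4.2, Lemma 3.1, Example 2.5] -/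
theorem setIntegral_sepOff_sq_le_of_noDoubleClash_pos (w : Sym2 V → unitInterval) (a b c : V)
    (hndc : ∀ ω η : Set (Sym2 V), (∀ e ∈ ω, (0 : ℝ) < w e) → (∀ e ∈ η, (0 : ℝ) < w e) →
      ¬ (openGraph ω).Reachable a b → ¬ (openGraph ω).Reachable a c →
      ¬ (openGraph ω).Reachable b c → ¬ (openGraph (η \ barOf {a} (setCl ω {a}))).Reachable b c →
      ¬ ((∃ y k : V, (openGraph ω).Reachable a k ∧ (0 : ℝ) < w s(k, y) ∧ (openGraph ω).Reachable b y ∧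
            (openGraph (η \ barOf {a} (setCl ω {a}))).Reachable c y) ∧
         (∃ y k : V, (openGraph ω).Reachable a k ∧ (0 : ℝ) < w s(k, y) ∧ (openGraph ω).Reachable c y ∧
            (openGraph (η \ barOf {a} (setCl ω {a}))).Reachable b y))) :
    (∫ ω in (openConn a b)ᶜ ∩ (openConn a c)ᶜ,
        (prodBernoulli w).real {η | ¬ (openGraph (η \ barOf {a} (setCl ω {a}))).Reachable b c} ^ 2 ∂(prodBernoulli w)) ≤
      (prodBernoulli w).real (openConn b c)ᶜ ^ 2 := by
  set p : Sym2 V → ℝ := fun e => (w e : ℝ) with hp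
  have hp0 : ∀ e, 0 ≤ p e := fun e => (w e).2.1
  have hp1 : ∀ e, p e ≤ 1 := fun e => (w e).2.2
  set P : Finset (Sym2 V) := Finset.univ.filter fun e => (0 : ℝ) < w e with hPdef
  have hP : ∀ e, e ∈ P ↔ (0 : ℝ) < w e := fun e => by simp [hPdef]
  refine (setIntegral_sepOff_sq_le_sq_add_doubleClash w a b c).trans ?_
  rw [Pr2W_eq_Pr2W_inter_supported w hP]
  have hcut : ∀ (K₁ K₂ : Finset (Sym2 V)) (t y : V), ¬ (openGraph (↑K₁ : Set (Sym2 V))).Reachable a t →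
      ((openGraph (↑(splice (revealedAt (Finset.univ : Finset (Sym2 V)) (∅ : Finset V) a K₁) K₁ K₂) :
        Set (Sym2 V))).Reachable t y ↔
      (openGraph ((↑K₂ : Set (Sym2 V)) \ barOf {a} (setCl (↑K₁ : Set (Sym2 V)) {a}))).Reachable t y) := by
    intro K₁ K₂ t y hat
    rw [← hybrid_coe_splice, reachable_hybrid_iff_diff_cutSet hat, barOf_setCl_singleton_eq_cutSet]
  have hle : Pr2W Finset.univ p
      (({x : Finset (Sym2 V) × Finset (Sym2 V) |
          (↑x.1 : Set (Sym2 V)) ∈ (openConn a b)ᶜ ∩ (openConn a c)ᶜ ∩ (openConn b c)ᶜ ∧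
          (↑(splice (revealedAt (Finset.univ : Finset (Sym2 V)) (∅ : Finset V) a x.1) x.1 x.2) : Set (Sym2 V)) ∈
            (openConn a b)ᶜ ∩ (openConn a c)ᶜ ∩ (openConn b c)ᶜ} ∩
        {x | (∃ y k : V, (openGraph (↑x.1 : Set (Sym2 V))).Reachable a k ∧ (0 : ℝ) < w s(k, y) ∧
              (openGraph (↑x.1 : Set (Sym2 V))).Reachable b y ∧
              (openGraph (↑(splice (revealedAt (Finset.univ : Finset (Sym2 V)) (∅ : Finset V) a x.1) x.1 x.2) :
                Set (Sym2 V))).Reachable c y) ∧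
            (∃ y k : V, (openGraph (↑x.1 : Set (Sym2 V))).Reachable a k ∧ (0 : ℝ) < w s(k, y) ∧
              (openGraph (↑x.1 : Set (Sym2 V))).Reachable c y ∧
              (openGraph (↑(splice (revealedAt (Finset.univ : Finset (Sym2 V)) (∅ : Finset V) a x.1) x.1 x.2) :
                Set (Sym2 V))).Reachable b y)}) ∩
        {x : Finset (Sym2 V) × Finset (Sym2 V) | x.1 ⊆ P ∧ x.2 ⊆ P}) ≤
      Pr2W Finset.univ p (∅ : Set (Finset (Sym2 V) × Finset (Sym2 V))) := by
    refine Pr2W_mono Finset.univ hp0 hp1 ?_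
    rintro ⟨K₁, K₂⟩ - - ⟨⟨⟨h1, h3⟩, ⟨y, k, hk, hw, hby, hcy⟩, ⟨y', k', hk', hw', hcy', hby'⟩⟩, ⟨hK₁, hK₂⟩⟩
    have hab : ¬ (openGraph (↑K₁ : Set (Sym2 V))).Reachable a b := h1.1.1
    have hac : ¬ (openGraph (↑K₁ : Set (Sym2 V))).Reachable a c := h1.1.2
    have hbc : ¬ (openGraph (↑K₁ : Set (Sym2 V))).Reachable b c := h1.2
    have hbc₃ : ¬ (openGraph ((↑K₂ : Set (Sym2 V)) \ barOf {a} (setCl (↑K₁ : Set (Sym2 V)) {a}))).Reachable b c :=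
      fun h => h3.2 ((hcut K₁ K₂ b c hab).2 h)
    have hpos₁ : ∀ e ∈ (↑K₁ : Set (Sym2 V)), (0 : ℝ) < w e := fun e he => (hP e).1 (hK₁ (Finset.mem_coe.1 he))
    have hpos₂ : ∀ e ∈ (↑K₂ : Set (Sym2 V)), (0 : ℝ) < w e := fun e he => (hP e).1 (hK₂ (Finset.mem_coe.1 he))
    exact (hndc ↑K₁ ↑K₂ hpos₁ hpos₂ hab hac hbc hbc₃ ⟨⟨y, k, hk, hw, hby, (hcut K₁ K₂ c y hac).1 hcy⟩,
      ⟨y', k', hk', hw', hcy', (hcut K₁ K₂ b y' hab).1 hby'⟩⟩).elim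
  have h0 : Pr2W Finset.univ p (∅ : Set (Finset (Sym2 V) × Finset (Sym2 V))) = 0 := by simp [Pr2W]
  linarith

end General

/-! ### `Fin n` forms -/

/-- **CSQ at `(a; b, c)` under "no double clash" for configurations of positive pairs.**
[cite: Gladkov2024, Thm. 4.3, Def. 4.2, Lemma 3.1, Example 2.5] -/
theorem clusterSquare_le_sq_of_noDoubleClash_pos {n : ℕ} (w : Sym2 (Fin n) → unitInterval) (a b c : Fin n)
    (hndc : ∀ ω η : BondConfig (Fin n), (∀ e ∈ ω, (0 : ℝ) < w e) → (∀ e ∈ η, (0 : ℝ) < w e) →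
      ¬ (openGraph ω).Reachable a b → ¬ (openGraph ω).Reachable a c →
      ¬ (openGraph ω).Reachable b c → ¬ (openGraph (η \ barOf {a} (setCl ω {a}))).Reachable b c →
      ¬ ((∃ y k : Fin n, (openGraph ω).Reachable a k ∧ (0 : ℝ) < w s(k, y) ∧ (openGraph ω).Reachable b y ∧
            (openGraph (η \ barOf {a} (setCl ω {a}))).Reachable c y) ∧
         (∃ y k : Fin n, (openGraph ω).Reachable a k ∧ (0 : ℝ) < w s(k, y) ∧ (openGraph ω).Reachable c y ∧
            (openGraph (η \ barOf {a} (setCl ω {a}))).Reachable b y))) :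
    clusterSquare w a b c ≤ (prodBernoulli w).real (openConn b c)ᶜ ^ 2 := by
  unfold clusterSquare sepOffCluster
  exact setIntegral_sepOff_sq_le_of_noDoubleClash_pos w a b c hndc

/-- **DUU at `(a; b, c)` under "no double clash" for configurations of positive pairs.** [cite: Gladkov2024, Thm. 5.2 and Thm. 4.3] -/
theorem sq_real_split_le_of_noDoubleClash_pos {n : ℕ} (w : Sym2 (Fin n) → unitInterval) (a b c : Fin n)
    (hndc : ∀ ω η : BondConfig (Fin n), (∀ e ∈ ω, (0 : ℝ) < w e) → (∀ e ∈ η, (0 : ℝ) < w e) →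
      ¬ (openGraph ω).Reachable a b → ¬ (openGraph ω).Reachable a c →
      ¬ (openGraph ω).Reachable b c → ¬ (openGraph (η \ barOf {a} (setCl ω {a}))).Reachable b c →
      ¬ ((∃ y k : Fin n, (openGraph ω).Reachable a k ∧ (0 : ℝ) < w s(k, y) ∧ (openGraph ω).Reachable b y ∧
            (openGraph (η \ barOf {a} (setCl ω {a}))).Reachable c y) ∧
         (∃ y k : Fin n, (openGraph ω).Reachable a k ∧ (0 : ℝ) < w s(k, y) ∧ (openGraph ω).Reachable c y ∧
            (openGraph (η \ barOf {a} (setCl ω {a}))).Reachable b y))) :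
    (prodBernoulli w).real ((openConn a b)ᶜ ∩ (openConn a c)ᶜ ∩ (openConn b c)ᶜ) ^ 2 ≤
      (prodBernoulli w).real ((openConn a b)ᶜ ∩ (openConn a c)ᶜ) * (prodBernoulli w).real (openConn b c)ᶜ ^ 2 :=
  (sq_real_split_le_real_mul_clusterSquare w a b c).trans
    (mul_le_mul_of_nonneg_left (clusterSquare_le_sq_of_noDoubleClash_pos w a b c hndc) measureReal_nonneg)

/-- **TS for `{a, b, c}` under "no double clash" at the root `a` for configurations of positive pairs.**
[cite: Gladkov2024, Thm. 5.2, Cor. 5.3 (pattern) and Thm. 4.3] -/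
theorem tripleSplit_of_noDoubleClash_pos {n : ℕ} (w : Sym2 (Fin n) → unitInterval) (a b c : Fin n)
    (hndc : ∀ ω η : BondConfig (Fin n), (∀ e ∈ ω, (0 : ℝ) < w e) → (∀ e ∈ η, (0 : ℝ) < w e) →
      ¬ (openGraph ω).Reachable a b → ¬ (openGraph ω).Reachable a c →
      ¬ (openGraph ω).Reachable b c → ¬ (openGraph (η \ barOf {a} (setCl ω {a}))).Reachable b c →
      ¬ ((∃ y k : Fin n, (openGraph ω).Reachable a k ∧ (0 : ℝ) < w s(k, y) ∧ (openGraph ω).Reachable b y ∧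
            (openGraph (η \ barOf {a} (setCl ω {a}))).Reachable c y) ∧
         (∃ y k : Fin n, (openGraph ω).Reachable a k ∧ (0 : ℝ) < w s(k, y) ∧ (openGraph ω).Reachable c y ∧
            (openGraph (η \ barOf {a} (setCl ω {a}))).Reachable b y))) :
    (prodBernoulli w).real ((openConn a b)ᶜ ∩ (openConn a c)ᶜ ∩ (openConn b c)ᶜ) ^ 2 ≤
      (prodBernoulli w).real (openConn a b)ᶜ * (prodBernoulli w).real (openConn a c)ᶜ *
        (prodBernoulli w).real (openConn b c)ᶜ := by
  set μ := prodBernoulli w with hμ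
  have hUV : μ.real (openConn b c)ᶜ ≤ μ.real ((openConn a b)ᶜ ∪ (openConn a c)ᶜ) := by
    refine measureReal_mono (fun ω hω => ?_) (measure_ne_top _ _)
    by_contra hV
    simp only [Set.mem_union, Set.mem_compl_iff, not_or, not_not] at hV
    exact hω (hV.1.symm.trans hV.2)
  have h0 : (0 : ℝ) ≤ μ.real (openConn b c)ᶜ := measureReal_nonneg
  have hD0 : (0 : ℝ) ≤ μ.real ((openConn a b)ᶜ ∩ (openConn a c)ᶜ) := measureReal_nonneg
  have h2 := real_inter_mul_real_union_le n w (openConn a b)ᶜ (openConn a c)ᶜ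
  calc μ.real ((openConn a b)ᶜ ∩ (openConn a c)ᶜ ∩ (openConn b c)ᶜ) ^ 2
      ≤ μ.real ((openConn a b)ᶜ ∩ (openConn a c)ᶜ) * μ.real (openConn b c)ᶜ ^ 2 :=
        sq_real_split_le_of_noDoubleClash_pos w a b c hndc
    _ = μ.real ((openConn a b)ᶜ ∩ (openConn a c)ᶜ) * μ.real (openConn b c)ᶜ * μ.real (openConn b c)ᶜ := by ring
    _ ≤ μ.real ((openConn a b)ᶜ ∩ (openConn a c)ᶜ) * μ.real ((openConn a b)ᶜ ∪ (openConn a c)ᶜ) *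
          μ.real (openConn b c)ᶜ :=
        mul_le_mul_of_nonneg_right (mul_le_mul_of_nonneg_left hUV hD0) h0
    _ ≤ μ.real (openConn a b)ᶜ * μ.real (openConn a c)ᶜ * μ.real (openConn b c)ᶜ := mul_le_mul_of_nonneg_right h2 h0

end Consts

end Summit.CriticalPhenomena.PercolationContinuityZ3.Theorems
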